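import Summits.QuantumFields.GaugeBoot.DiagonalRPTorusRestReduction
import HarnessLib

/-!
# From the jet of the near pair to a uniform window (gauge-boot, L3 `d = 3` uniform window,
# brick 6a)

HONEST FRAMING (cell `pub-gaugeboot`, page 1 of every file): the venture produces certified bounds
on lattice expectations at stated coupling, gauge group, dimension and torus size; NOT a mass gap,
NOT a continuum limit, NOT a string tension; NOT Yang–Mills-summit-bearing (barriers
`FixedCouplingUltralocality`, `PerturbativeInvisibility`). This module is the ANALYTIC half of the
last step of the uniform-in-`L` programme for the torus diagonal-RP negatives
(`HOME/pub-gaugeboot-lean3/gen46/D3-UNIFORM-PLAN.md`): it turns a statement about the TAYLOR JET at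
`β = 0` of the near-pair truncated rest correlation (a fixed-`L`, finite-volume, combinatorial
statement — NOT proved here, the crux of the `d = 3` leg) into a coupling window UNIFORM in `L`.
It proves no window by itself.

## Content (torus `(ℤ/L)^d`, compact metrisable `G`, continuous `ρ`)

* `restTruncC V f g z` — the truncated rest correlation as a function of the COMPLEX coupling `z`
  (the Literature's `PlaqSystem.expect` of the torus system on the label set of `V`, through the
  dictionary of `DiagonalRPTorusRestDictionary`); `ofReal_restTrunc_eq_restTruncC` (it extends the
  real one), `differentiableOn_restTruncC` (holomorphic on the strong-coupling disc
  `‖z‖ < betaOne d ρ`), `norm_restTruncC_le` (bounded there by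
  `K₀ = 2 C_f C_g κ₀^{(#E₁+#E₂)2^d d²}`, INDEPENDENT of `L` and `V`).
* ★ **`restTrunc_ge_of_jet`** — the Schwarz lemma with multiplicity (Literature
  `norm_le_of_isBigO_pow`): if `restTruncC z - c z^m = O(z^{m+1})` at `z = 0` (the jet: all
  coefficients below order `m` vanish and the `m`-th is the real number `c`), then for
  `0 ≤ β ≤ r < betaOne d ρ`

  `restTrunc V f g ≥ c β^m - (K₀ + |c| β₁^m) (β/r)^{m+1}`,  `β₁ = betaOne d ρ`,

  with every constant independent of `L` and `V` — a UNIFORM lower bound from a fixed-`L` jet.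
* ★★ **`trickForm_sub_translate_neg_of_jet`** — combined with the reduction
  `DiagonalRPTorusRestReduction.trickForm_sub_translate_le`: for a bounded measurable `O` reading
  links within `r₀` of `y₀`, a translation `a` inside the layers, a near-pair jet
  `κ(O∘Θ, O∘τ_a)(z) = c z^m + O(z^{m+1})` with `c > 0`, and `2r₀ + m + 3 ≤ cyc δ(y₀)` (the far
  pairs are beyond the jet order), the trick form of `O - O∘τ_a` is NEGATIVE for every
  `0 < β < β⋆`, where `β⋆ = min r (c r^{m+1} / (4 C² κ₀^{2#E 2^d d²} + K₀ + |c| β₁^m + 1))` does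
  NOT depend on `L`: the uniform window, CONDITIONAL on the jet.

What feeds it (open, plan note §3 item 6): for the bent hexagons of `d = 3`, `m = 10` and
`c = τ₁₀ > 0` (orders `≤ 9` vanish by lonely links and the forest principle of
`TreeGaugeFactorization`; order `10` = the annuli); in `d ≥ 4`, `m = 8` (gen 43's tubes).
Elementary given the Literature layer; no named fact.
-/

open MeasureTheory Finset Function Filter Asymptotics
open scoped Topology

namespace Summit.QuantumFields.GaugeBoot

open Literature.MathematicalPhysics.QuantumFieldTheory

noncomputable section

namespace DiagRPUnif

open DiagRPTube

variable {d L : ℕ} [NeZero L] {N : ℕ} {G : Type*} [Group G] [TopologicalSpace G]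
  [IsTopologicalGroup G] [CompactSpace G] [MeasurableSpace G] [BorelSpace G]
  [SecondCountableTopology G] (ρ : G →* Matrix (Fin N) (Fin N) ℂ)

/-! ## The truncated rest correlation at complex coupling -/

/-- The truncated rest correlation as a function of the COMPLEX coupling (the torus plaquette
system with the labels of `V` switched on, through `torusSigma`). -/
def restTruncC (V : Finset (Plaquette d L)) (f g : GaugeConfig d L G → ℝ) (z : ℂ) : ℂ :=
  (torusSystem ρ L).expect
      (fun U => ((f (torusSigma L U) : ℝ) : ℂ) * ((g (torusSigma L U) : ℝ) : ℂ)) (V.image tlab) z -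
    (torusSystem ρ L).expect (fun U => ((f (torusSigma L U) : ℝ) : ℂ)) (V.image tlab) z *
      (torusSystem ρ L).expect (fun U => ((g (torusSigma L U) : ℝ) : ℂ)) (V.image tlab) z

/-- At real coupling it is the real truncated rest correlation. -/
theorem ofReal_restTrunc_eq_restTruncC (hρ : Continuous ρ) (β : ℝ) (V : Finset (Plaquette d L))
    {f g : GaugeConfig d L G → ℝ} (hfm : Measurable f) (hgm : Measurable g) :
    ((restTrunc ρ β V f g : ℝ) : ℂ) = restTruncC ρ V f g (β : ℂ) :=
  ofReal_restTrunc_eq ρ β hρ V hfm hgm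

section Analytic

variable {ρ}

omit [NeZero L] [Group G] [TopologicalSpace G] [IsTopologicalGroup G] [CompactSpace G]
  [BorelSpace G] [SecondCountableTopology G] in
/-- Measurability and bounds of the lifted observables. -/
private theorem lift_meas_bound {f : GaugeConfig d L G → ℝ} (hfm : Measurable f) {C : ℝ}
    (hfb : ∀ U, |f U| ≤ C) :
    Measurable (fun U : ZdGaugeConfig d G => ((f (torusSigma L U) : ℝ) : ℂ)) ∧
      ∀ U : ZdGaugeConfig d G, ‖((f (torusSigma L U) : ℝ) : ℂ)‖ ≤ C :=
  ⟨Complex.measurable_ofReal.comp (hfm.comp (measurable_torusSigma L)), fun U => by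
    rw [Complex.norm_real, Real.norm_eq_abs]; exact hfb _⟩

omit [SecondCountableTopology G] in
/-- **Holomorphy**: `restTruncC` is holomorphic on the strong-coupling disc `‖z‖ < betaOne d ρ`. -/
theorem differentiableOn_restTruncC (hρ : Continuous ρ) (V : Finset (Plaquette d L))
    {f g : GaugeConfig d L G → ℝ} (hfm : Measurable f) (hgm : Measurable g) {Cf Cg : ℝ}
    (hfb : ∀ U, |f U| ≤ Cf) (hgb : ∀ U, |g U| ≤ Cg) :
    DifferentiableOn ℂ (restTruncC ρ V f g) (Metric.ball 0 (betaOne d ρ)) := by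
  obtain ⟨h1m, h1b⟩ := lift_meas_bound (L := L) hfm hfb
  obtain ⟨h2m, h2b⟩ := lift_meas_bound (L := L) hgm hgb
  have hCf : 0 ≤ Cf := (abs_nonneg _).trans (hfb 1)
  have h12 : ∀ U : ZdGaugeConfig d G,
      ‖((f (torusSigma L U) : ℝ) : ℂ) * ((g (torusSigma L U) : ℝ) : ℂ)‖ ≤ Cf * Cg := fun U => by
    rw [norm_mul]; exact mul_le_mul (h1b U) (h2b U) (norm_nonneg _) hCf
  have hR := torusSystem_regular (d := d) ρ hρ (L := L)
  rw [← betaR_costBound]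
  exact (PlaqSystem.differentiableOn_expect hR (h1m.mul h2m) h12 _).sub
    ((PlaqSystem.differentiableOn_expect hR h1m h1b _).mul
      (PlaqSystem.differentiableOn_expect hR h2m h2b _))

omit [SecondCountableTopology G] in
/-- **Uniform bound on the disc**: `‖restTruncC z‖ ≤ 2 C_f C_g κ₀^{(#E₁+#E₂)2^d d²}` for
`‖z‖ < betaOne d ρ`, with `κ₀ = 2e^{1/2}` — independent of `L` and of `V`. -/
theorem norm_restTruncC_le (hρ : Continuous ρ) (V : Finset (Plaquette d L))
    {f g : GaugeConfig d L G → ℝ} (hfm : Measurable f) (hgm : Measurable g) {Cf Cg : ℝ}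
    (hfb : ∀ U, |f U| ≤ Cf) (hgb : ∀ U, |g U| ≤ Cg) {E₁ E₂ : Finset (Edge d L)}
    (hfE : DependsOn f (E₁ : Set (Edge d L))) (hgE : DependsOn g (E₂ : Set (Edge d L)))
    {z : ℂ} (hz : z ∈ Metric.ball (0 : ℂ) (betaOne d ρ)) :
    ‖restTruncC ρ V f g z‖ ≤
      2 * Cf * Cg * (2 * Real.exp (1 / 2)) ^ ((E₁.card + E₂.card) * (2 ^ d * (d * d))) := by
  obtain ⟨h1m, h1b⟩ := lift_meas_bound (L := L) hfm hfb
  obtain ⟨h2m, h2b⟩ := lift_meas_bound (L := L) hgm hgb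
  have hCf : 0 ≤ Cf := (abs_nonneg _).trans (hfb 1)
  have hCg : 0 ≤ Cg := (abs_nonneg _).trans (hgb 1)
  have hz' : ‖z‖ ≤ PlaqSystem.betaR (costBound ρ) (Plaq.degBound d) := by
    rw [betaR_costBound]; exact (mem_ball_zero_iff.1 hz).le
  have h1d : DependsOn (fun U : ZdGaugeConfig d G => ((f (torusSigma L U) : ℝ) : ℂ))
      ((E₁.image (torusSect L) : Finset (ZdEdge d)) : Set (ZdEdge d)) :=
    dependsOn_comp_torusSigma (f := fun W => ((f W : ℝ) : ℂ)) fun U U' h => by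
      show ((f U : ℝ) : ℂ) = f U'; rw [hfE h]
  have h2d : DependsOn (fun U : ZdGaugeConfig d G => ((g (torusSigma L U) : ℝ) : ℂ))
      ((E₂.image (torusSect L) : Finset (ZdEdge d)) : Set (ZdEdge d)) :=
    dependsOn_comp_torusSigma (f := fun W => ((g W : ℝ) : ℂ)) fun U U' h => by
      show ((g U : ℝ) : ℂ) = g U'; rw [hgE h]
  have hb := PlaqSystem.norm_truncatedExpect_le_const
    (torusSystem_regular (d := d) ρ hρ (L := L)) hz'
    h1m h2m h1b h2b h1d h2d (V.image tlab)
  refine hb.trans ?_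
  -- seed counts, uniformly in `L`
  set κ : ℝ := 2 * Real.exp (1 / 2) with hκ
  have hκ1 : 1 ≤ κ := by rw [hκ]; nlinarith [Real.add_one_le_exp (1 / 2 : ℝ)]
  set S := torusSystem (G := G) ρ L
  have hs₁ := card_seedsOf_image_torusSect_le (G := G) ρ (L := L) E₁
  have hs₂ := card_seedsOf_image_torusSect_le (G := G) ρ (L := L) E₂
  have hs₁₂ : (S.seedsOf (E₁.image (torusSect L) ∪ E₂.image (torusSect L))).card ≤
      (E₁.card + E₂.card) * (2 ^ d * (d * d)) := by
    rw [← image_union]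
    refine (card_seedsOf_image_torusSect_le ρ _).trans ?_
    exact Nat.mul_le_mul_right _ (card_union_le _ _)
  set s := (E₁.card + E₂.card) * (2 ^ d * (d * d)) with hs
  have e1 : κ ^ (S.seedsOf (E₁.image (torusSect L) ∪ E₂.image (torusSect L))).card ≤ κ ^ s :=
    pow_le_pow_right₀ hκ1 hs₁₂
  have e2 : κ ^ (S.seedsOf (E₁.image (torusSect L))).card *
      κ ^ (S.seedsOf (E₂.image (torusSect L))).card ≤ κ ^ s := by
    rw [← pow_add]
    refine pow_le_pow_right₀ hκ1 ?_
    rw [hs, add_mul]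
    exact add_le_add hs₁ hs₂
  have hCC : 0 ≤ Cf * Cg := mul_nonneg hCf hCg
  have h2 : Cf * κ ^ (S.seedsOf (E₁.image (torusSect L))).card *
      (Cg * κ ^ (S.seedsOf (E₂.image (torusSect L))).card) =
      Cf * Cg * (κ ^ (S.seedsOf (E₁.image (torusSect L))).card *
        κ ^ (S.seedsOf (E₂.image (torusSect L))).card) := by ring
  rw [h2]
  nlinarith [mul_le_mul_of_nonneg_left e1 hCC, mul_le_mul_of_nonneg_left e2 hCC]

/-- ★ **FROM THE JET TO A UNIFORM LOWER BOUND** (Schwarz lemma with multiplicity). If the complex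
truncated rest correlation has the jet `c z^m + O(z^{m+1})` at `z = 0` (`c` real), then for
`0 ≤ β ≤ r < betaOne d ρ`:
`restTrunc V f g ≥ c β^m - (K₀ + |c| β₁^m) (β/r)^{m+1}`, `K₀ = 2 C_f C_g κ₀^{(#E₁+#E₂)2^d d²}`,
`β₁ = betaOne d ρ` — every constant independent of `L` and `V`. -/
theorem restTrunc_ge_of_jet (hρ : Continuous ρ) (V : Finset (Plaquette d L))
    {f g : GaugeConfig d L G → ℝ} (hfm : Measurable f) (hgm : Measurable g) {Cf Cg : ℝ}
    (hfb : ∀ U, |f U| ≤ Cf) (hgb : ∀ U, |g U| ≤ Cg) {E₁ E₂ : Finset (Edge d L)}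
    (hfE : DependsOn f (E₁ : Set (Edge d L))) (hgE : DependsOn g (E₂ : Set (Edge d L)))
    {m : ℕ} {c : ℝ}
    (hjet : (fun z => restTruncC ρ V f g z - (c : ℂ) * z ^ m) =O[𝓝 (0 : ℂ)] fun z => z ^ (m + 1))
    {r : ℝ} (hr : 0 < r) (hrR : r < betaOne d ρ) {β : ℝ} (hβ0 : 0 ≤ β) (hβr : β ≤ r) :
    c * β ^ m - (2 * Cf * Cg * (2 * Real.exp (1 / 2)) ^ ((E₁.card + E₂.card) * (2 ^ d * (d * d))) +
        |c| * betaOne d ρ ^ m) * (β / r) ^ (m + 1) ≤ restTrunc ρ β V f g := by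
  set K₀ : ℝ := 2 * Cf * Cg * (2 * Real.exp (1 / 2)) ^ ((E₁.card + E₂.card) * (2 ^ d * (d * d)))
    with hK₀
  set hfun : ℂ → ℂ := fun z => restTruncC ρ V f g z - (c : ℂ) * z ^ m with hh
  have hd : DifferentiableOn ℂ hfun (Metric.ball 0 (betaOne d ρ)) :=
    (differentiableOn_restTruncC hρ V hfm hgm hfb hgb).sub
      ((differentiable_const _).mul (differentiable_pow m)).differentiableOn
  have hK : ∀ z ∈ Metric.ball (0 : ℂ) (betaOne d ρ), ‖hfun z‖ ≤ K₀ + |c| * betaOne d ρ ^ m := by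
    intro z hz
    refine (norm_sub_le _ _).trans
      (add_le_add (norm_restTruncC_le hρ V hfm hgm hfb hgb hfE hgE hz) ?_)
    rw [norm_mul, Complex.norm_real, Real.norm_eq_abs, norm_pow]
    exact mul_le_mul_of_nonneg_left
      (pow_le_pow_left₀ (norm_nonneg _) (mem_ball_zero_iff.1 hz).le m) (abs_nonneg _)
  have hβ' : ‖(β : ℂ)‖ ≤ r := by
    rw [Complex.norm_real, Real.norm_eq_abs, abs_of_nonneg hβ0]; exact hβr
  have hmain := norm_le_of_isBigO_pow hd hK hjet hr hrR hβ'
  have hnβ : ‖(β : ℂ)‖ = β := by rw [Complex.norm_real, Real.norm_eq_abs, abs_of_nonneg hβ0]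
  rw [hnβ] at hmain
  -- the real part
  have hre : hfun (β : ℂ) = ((restTrunc ρ β V f g - c * β ^ m : ℝ) : ℂ) := by
    rw [hh]
    simp only [← ofReal_restTrunc_eq_restTruncC ρ hρ β V hfm hgm]
    push_cast
    ring
  rw [hre, Complex.norm_real, Real.norm_eq_abs] at hmain
  have := (abs_le.1 hmain).1
  linarith

end Analytic

/-! ## The uniform window, conditional on the jet of the near pair -/

section Window

variable {ρ} (β : ℝ) (i j : Fin d) (h : ℕ)

/-- ★★ **UNIFORM WINDOW FROM THE JET OF THE NEAR PAIR.** Let `O` be bounded measurable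
(`|O| ≤ C`), reading links `E` within torus distance `r₀` of `y₀`; `a` a translation inside the
layers (`δ(a) = 0`); suppose the NEAR PAIR `κ(O∘Θ, O∘τ_a)` has the complex jet
`c z^m + O(z^{m+1})`, and the mirror image is far: `2r₀ + m + 3 ≤ cyc δ(y₀)`. Then for
every `0 < β < β⋆`,
`β⋆ = min r (c r^{m+1} / (2·(2C²κ₀^{2#E 2^d d²}) + (2C²κ₀^{2#E 2^d d²} + |c| β₁^m) + 1))`
(`0 < r < β₁ = betaOne d ρ` arbitrary; NOTHING depends on `L`; the window is empty unless `c > 0`),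
the trick form of `O - O∘τ_a` is NEGATIVE — feed
`DiagRPTube.not_innerDiagonalRP_of_trickForm_neg`. -/
theorem trickForm_sub_translate_neg_of_jet (hρ : Continuous ρ) {O : GaugeConfig d L G → ℝ}
    (hOm : Measurable O) {C : ℝ} (hOb : ∀ U, |O U| ≤ C) {E : Finset (Edge d L)}
    (hOE : DependsOn O (E : Set (Edge d L))) {y₀ : Site d L} {r₀ : ℕ}
    (hE : ∀ e ∈ E, tsd y₀ e.1 ≤ r₀) {a : Site d L} (ha : lay i j a = 0) {m : ℕ} {c : ℝ}
    (hjet : (fun z => restTruncC ρ (restPlaqs i j h) (fun U => O (configDiagSwap i j U))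
        (fun U : GaugeConfig d L G => O (U.siteTranslate a)) z - (c : ℂ) * z ^ m)
        =O[𝓝 (0 : ℂ)] fun z => z ^ (m + 1))
    (hfar : 2 * r₀ + m + 3 ≤ cyc (lay i j y₀)) {r : ℝ} (hr : 0 < r) (hrR : r < betaOne d ρ)
    (hβ0 : 0 < β) (hβr : β ≤ r)
    (hβc : β < c * r ^ (m + 1) /
      (2 * (2 * C * C * (2 * Real.exp (1 / 2)) ^ ((E.card + E.card) * (2 ^ d * (d * d)))) +
        (2 * C * C * (2 * Real.exp (1 / 2)) ^ ((E.card + E.card) * (2 ^ d * (d * d))) +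
          |c| * betaOne d ρ ^ m) + 1)) :
    trickForm ρ i j h β (fun U : GaugeConfig d L G => O U - O (U.siteTranslate a)) < 0 := by
  set K : ℝ := 2 * C * C * (2 * Real.exp (1 / 2)) ^ ((E.card + E.card) * (2 ^ d * (d * d)))
    with hK
  have hK0 : 0 ≤ K := by
    have hC : 0 ≤ C := (abs_nonneg _).trans (hOb 1)
    rw [hK]; positivity
  have hfar' : 2 * r₀ < cyc (lay i j y₀) := by omega
  -- the near pair: uniform lower bound from the jet
  have hOτm : Measurable fun U : GaugeConfig d L G => O (U.siteTranslate a) :=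
    measurable_comp_siteTranslate a hOm
  have hnear := restTrunc_ge_of_jet hρ (restPlaqs i j h) (measurable_comp_configDiagSwap i j hOm)
    hOτm (Cf := C) (Cg := C) (fun U => hOb _) (fun U => hOb _)
    (dependsOn_comp_configDiagSwap hOE) (dependsOn_comp_siteTranslate hOE a) hjet hr hrR hβ0.le hβr
  rw [card_image_of_injective _ (Function.Involutive.injective (edgeDiagSwap_edgeDiagSwap i j)),
    card_image_of_injective _ (fun e e' hee' => by
      simpa [Prod.ext_iff, add_left_inj] using hee' :
        Function.Injective fun e : Edge d L => (e.1 + a, e.2))] at hnear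
  -- the far pairs decay at least like `(β/r)^{m+1}`
  have hq : β / r ≤ 1 := (div_le_one hr).2 hβr
  have hq0 : 0 ≤ β / r := div_nonneg hβ0.le hr.le
  have hpow : (β / r) ^ (cyc (lay i j y₀) - (r₀ + r₀ + 2)) ≤ (β / r) ^ (m + 1) :=
    pow_le_pow_of_le_one hq0 hq (by omega)
  refine trickForm_sub_translate_neg ρ β i j h hρ hOm hOb hOE hE ha hfar' hr hrR hβ0.le hβr hnear ?_
  -- the window inequality: `K q^{m+1-ish} + (K + |c|β₁^m) q^{m+1} < c β^m`, `q = β/r`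
  have hq1 : (β / r) ^ (m + 1) = β ^ m * (β / r ^ (m + 1)) := by
    rw [div_pow, pow_succ]; ring
  have hcb : 0 ≤ |c| * betaOne d ρ ^ m :=
    mul_nonneg (abs_nonneg c) (pow_nonneg (betaOne_pos d (ρ := ρ)).le m)
  have hden : 0 < 2 * K + (K + |c| * betaOne d ρ ^ m) + 1 := by linarith
  have hβc' : β * (2 * K + (K + |c| * betaOne d ρ ^ m) + 1) < c * r ^ (m + 1) := by
    rwa [lt_div_iff₀ hden] at hβc
  have hrpow : 0 < r ^ (m + 1) := pow_pos hr _
  have hβm : 0 < β ^ m := pow_pos hβ0 m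
  -- everything in terms of `t = β^m · β / r^{m+1}`
  have key : K * (β / r) ^ (cyc (lay i j y₀) - (r₀ + r₀ + 2)) +
      (K + |c| * betaOne d ρ ^ m) * (β / r) ^ (m + 1) < c * β ^ m := by
    have h1 : K * (β / r) ^ (cyc (lay i j y₀) - (r₀ + r₀ + 2)) ≤ K * (β / r) ^ (m + 1) :=
      mul_le_mul_of_nonneg_left hpow hK0
    have h2 : (2 * K + (K + |c| * betaOne d ρ ^ m) + 1) * (β / r) ^ (m + 1) < c * β ^ m := by
      rw [hq1]
      have : (2 * K + (K + |c| * betaOne d ρ ^ m) + 1) * (β / r ^ (m + 1)) < c := by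
        rw [← mul_div_assoc, div_lt_iff₀ hrpow]; linarith
      nlinarith
    have hKq : 0 ≤ K * (β / r) ^ (m + 1) := mul_nonneg hK0 (pow_nonneg hq0 _)
    nlinarith [pow_nonneg hq0 (m + 1)]
  linarith

end Window

end DiagRPUnif

end

end Summit.QuantumFields.GaugeBoot
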